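import Summits.QuantumFields.YangMills.Theorems.UnitScaleTiltProp7MassivePropagatorCoercive
import Summits.QuantumFields.YangMills.Theorems.UnitScaleTiltProp7CorrectorAgmonDecay
import Mathlib.Analysis.InnerProductSpace.ProdL2
import Literature.MathematicalPhysics.QuantumFieldTheory.Balaban1983to89.Beta.CombesThomasForm
import HarnessLib

/-!
# Route `UnitScaleTilt`, crux «MinimiserStabilityRegPr» (stmt-QuantumFields-19200, stub EX), positivity block, the LOD ∕ Combes–Thomas line (★p1 g24 `LOCATE-P349-CT` v2 §7 (E2);
# ★★OWNER RULING №35 «(L3′a) GO in R3»; chair 22:12:46Z «px5 g11 ← (L3′a) MEMBER FILE», pins 22:17:29Z (2) «export (A-L²) AND (A-H¹)») — **(L3′a) FILE C: THE WEIGHTED-L² AND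
# WEIGHTED-H¹ AGMON ROWS OF THE MASSIVE COVARIANT PROPAGATOR `G_a = (Δ_{U₀} + a·Q″†Q″)⁻¹` AT THE T³ MEMBER, K-UNIFORM** — for every positive weight `w` on the fine sites with
# bond ratios `|w(b₊)∕w(b₋) − 1| ≤ ρ` and in-block ratios `|w(x)∕w_c(B(x)) − 1| ≤ ρ′`, and every solution of `(Δ_{U₀} + a·T(ι(Q″·)))u = f`:
# `‖w·u‖ ≤ 8C_P²·‖w·f‖` and `‖D_{U₀}(w·u)‖² + a‖ι(Q″(w·u))‖² ≤ (4C_P·‖w·f‖)²`, `C_P² = max 2 (16c₀(L^{K−n})³∕(a c₁))` the (L2′-GAP) constant, in the window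
# `C_P·δ₁ ≤ 1∕10`, `δ₁² ≥ 3η⁻²ρ² + (25∕8)κ·a·ρ′²` (ym3-torus-px5 g11, `LOCATE-L3a-px5g11.md`; engine = the namer's ✓`Prop7CorrectorAgmonDecay.agmon_corrector_bound` at `Pt := id`).

Cell `ym3-torus` (HUMAN RULING D-0037: YM₃ on T³ is ladder rung R3 — NOT d = 4, NOT infinite volume, NOT a mass gap, NOT Clay).  Width seat `ym3-torus-px5` (gen 11; WIDTH COPY of
ym3-torus-p1).  THEOREMS ONLY (0 `def`, 0 `sorry`); `--supports stmt-QuantumFields-19200 --as helper`, count-neutral.  HONEST LABEL (№35 (6)): «(L3′a) = [Balaban1985BackgroundPropagators]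
(3.46)-class weighted-L² Agmon row by a Combes–Thomas ∕ Agmon argument at the T³ member; (3.42) pointwise (L3′b) NOT claimed; feeds `hGF`[Lift] via (L5′)∕(L4); does NOT feed `h349`[Lift] alone».

THE OBJECTS (all hypothesis-form, no definition).  `E := SiteL2K ℂ 3 (periodsT3 F K) c₀ W₂`; `Q''` ANY linear map with clauses (iii)+(iv) of ✓`exists_intertwiner_of_regPr` (the `hseq` of
✓p746531 VERBATIM); `ι` THE BLOCK-CONSTANT LIFT `c ↦ toL2S F n c₁ (c ∘ siteShift)` into `SiteL2K ℂ 3 (periodsT3 F n) c₁ W₂` (`hι`); `T` any adjoint of `ι∘Q″` (`hT : ⟪ι(Q″λ), f⟫ = ⟪λ, Tf⟫`,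
✓p747466 `inner_adjoint_comp` supplies one); the MASSIVE OPERATOR `A λ := covLapSite U₀ λ + a·T(ι(Q″λ))` (print's `Δ′_a = Δ^η_U + Q′*aQ′`, (3.24)); its gap `re⟪λ, Aλ⟫ = ‖D_{U₀}λ‖² +
a‖ι(Q″λ)‖² ≥ C_P⁻²‖λ‖²` is (L2′-GAP) ✓p747976 read through `hι`.  THE ENGINE: ✓`agmon_corrector_bound` with `D := D̃ = D_{U₀} ⊕ √a·ι∘Q″ : E → WithLp 2 (BondL2K × SiteL2K_n)`,
`Pt := id` (no constraint: `K₂ = K₂′ = 0`), weights `M = w·` on sites, `M′ = w(b₋)· ⊕ (w_c∘B)·` on bonds ⊕ coarse sites, defects `K₁ = (η⁻¹(w₊∕w₋ − 1)·Ad(U₀)λ(·₊)) ⊕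
(√a·ι(Q″((w∕(w_c∘B) − 1)·λ)))` (FILE A §4 + §2: `Q″` commutes with the block-constant `w_c∘B`), `‖K₁‖ ≤ δ₁` by FILE A `normSq_gradDefect_le` + `normSq_lift_topMean_le`.

WHAT IS PROVED (sorry-free, no definition; ns `…Theorems.Prop7MassivePropagatorAgmon`; letters FILE A `…AgmonLetters`, operator FILE B `…Coercive`).
* ★★★`agmon_rows_of_massive_eq` — THE TWO ROWS for a positive weight pair `(w, w_c)` with ratio bounds `ρ, ρ′` in the window `C_P·δ₁ ≤ 1∕10`:
  (A-L²) `‖toL2S(w·u)‖ ≤ 8C_P²·‖toL2S(w·f)‖` and (A-H¹) `‖DL2 U₀ (toL2S(w·u))‖² + a·‖ι(Q''(toL2S(w·u)))‖² ≤ (4C_P·‖toL2S(w·f)‖)²`.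
* ★★★`agmon_rows_exp` (lit ✓`Beta.CombesThomasForm.abs_exp_sub_one_le` for `|e^{t} − 1| ≤ e^{θ} − 1`) — the same for `w = e^{φ}`, `w_c = e^{φ_c}` with `|φ(b₊) − φ(b₋)| ≤ θ`, `|φ(x) − φ_c(B(x))| ≤ θ′`
  (`ρ = e^{θ} − 1`, `ρ′ = e^{θ′} − 1`): the (3.46)-CLASS WEIGHTED DECAY the coarse Gram route (routeR-w2 (L5′-member)) and the IMS stage (w5 (L4)) consume with
  `φ = μη·dist(·, B_y)` (`θ = μη`, `θ′ ≤ 3μ`; `η⁻¹ρ ≤ e·μ` for `μη ≤ 1`).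
HONEST SCOPE.  (3.46)-class L²∕H¹ rows only; (3.42) pointwise (L3′b), the Gram∕`M⁻¹`∕`P` assembly (L5′), IMS (L4), local gauge (L5), and `hGF`∕`h349`∕EX are NOT here; nothing continuum ∕ OS ∕
mass-gap ∕ Clay.

References: T. Bałaban, CMP **99** (1985) 389–434 [Balaban1985BackgroundPropagators] (Thm 3.1 (3.46) p.398, (3.24)–(3.25) p.394, Thm 3.11 p.416); CMP **89** (1983) 571–597
[Balaban1983RegularityDecay] ((1.8) p.573); S. Agmon, *Lectures on exponential decay of solutions of second-order elliptic equations* (Princeton 1982) Ch. 1 [Agmon1982]; A. Målqvist,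
D. Peterseim, Math. Comp. **83** (2014) 2583–2603 (LOD corrector decay — the engine's shape).
-/

set_option autoImplicit false

noncomputable section

open scoped BigOperators Matrix.Norms.L2Operator InnerProductSpace ComplexConjugate

namespace Summit.QuantumFields.YangMills.Theorems.Prop7MassivePropagatorAgmon

open Literature.MathematicalPhysics.QuantumFieldTheory.Balaban1983to89
open Finset
open T4Continuum BlockAveraging
open BlockAveraging (Idx)
open B7Prop1Explicit (U1 disp)
open B5Eq118OneStroke (iterBlockOf iterBlock)
open B10Eq27TorusAxialLog (holT transl)
open B7TransferAnalyticMean (meanCLM)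
open B9Eq311L2Pairing (WL2)
open B11Eq103H1Complex (SiteL2K BondL2K)
open B9Eq39Adjoint (R)
open Summit.QuantumFields.YangMills.Theorems.Prop8Chart (emlIterU)
open Literature.MathematicalPhysics.QuantumFieldTheory.Balaban1983to89.T3ContinuumYM3Torus
open T3SectALandauChart (eta eta_pos bgUnits)
open T3PrintedRegularMinimiser (RegPr)
open T3PrintedRegularOrbits (sites_eq)
open T3LevelShift (siteShift)
open Summit.QuantumFields.YangMills.Theorems.Prop7SectET3Transport (periodsT3)
open Summit.QuantumFields.YangMills.Theorems.Prop7SectET3HilbertLetters (W₂ toL2 toL2S DL2 DstarL2 covLapSite adjoint_DL2 inner_toL2)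
open Summit.QuantumFields.YangMills.Theorems.Prop7SectET3RealCoordSums (inner_toL2S)
open Summit.QuantumFields.YangMills.Theorems.Prop7BlockBumpExtension (normSq_toL2S_comp_siteShift_eq)
open Summit.QuantumFields.YangMills.Theorems.Prop7BlockPoincareTopMeanKept (normSq_le_two_mul_normSq_DL2_add_topMean_frob)
open Summit.QuantumFields.YangMills.Theorems.Prop7MassivePropagatorAgmonLetters
open Summit.QuantumFields.YangMills.Theorems.Prop7MassivePropagatorCoercive
open Summit.QuantumFields.YangMills.Theorems.Prop7CorrectorAgmonDecay (agmon_corrector_bound)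
open Literature.MathematicalPhysics.QuantumFieldTheory.Balaban1983to89.Beta.CombesThomasForm (abs_exp_sub_one_le)

variable (F : T3Family) {n K : ℕ} (h : n ≤ K) {c₀ c₁ : ℝ} [Fact (0 < c₀)] [Fact (0 < c₁)]
  {ε₀ : ℝ} (hε₀ : 0 < ε₀) (hε7 : 10 ^ 7 * (F.L : ℝ) ^ 3 * ε₀ ≤ 1)
  (U₀ : GaugeField (F.P K) 0 (Matrix.specialUnitaryGroup (Fin 2) ℂ)) (hreg : RegPr F n K ε₀ U₀)
  (Q'' : SiteL2K ℂ 3 (periodsT3 F K) c₀ W₂ →ₗ[ℂ] (Site (F.P K) (K - n) → Matrix (Fin 2) (Fin 2) ℂ))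
  (hseq : ∀ lam : Site (F.P K) 0 → Matrix (Fin 2) (Fin 2) ℂ, ∃ ns : (j : ℕ) → Site (F.P K) j → Matrix (Fin 2) (Fin 2) ℂ, ns 0 = lam ∧
      (∀ (j : ℕ) (y : Site (F.P K) (j + 1)), ns (j + 1) y = ns j (emb y) - meanCLM (Idx (F.P K)) (Matrix (Fin 2) (Fin 2) ℂ) fun i : Idx (F.P K) =>
        ns j (emb y) - ((holT (emlIterU j (bgUnits F K U₀)) (emb y) (stairWord i.2.1 (off i.1)) : (Matrix (Fin 2) (Fin 2) ℂ)ˣ) : Matrix (Fin 2) (Fin 2) ℂ) *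
          ns j (transl (emb y) (disp (stairWord i.2.1 (off i.1)))) * (((holT (emlIterU j (bgUnits F K U₀)) (emb y) (stairWord i.2.1 (off i.1)))⁻¹ : (Matrix (Fin 2) (Fin 2) ℂ)ˣ) : Matrix (Fin 2) (Fin 2) ℂ)) ∧
      ns (K - n) = Q'' (toL2S F K c₀ lam))
  (ι : (Site (F.P K) (K - n) → Matrix (Fin 2) (Fin 2) ℂ) →ₗ[ℂ] SiteL2K ℂ 3 (periodsT3 F n) c₁ W₂)
  (hι : ∀ c, ι c = toL2S F n c₁ (fun z => c (siteShift (sites_eq F n K h) z)))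
  (T : SiteL2K ℂ 3 (periodsT3 F n) c₁ W₂ →ₗ[ℂ] SiteL2K ℂ 3 (periodsT3 F K) c₀ W₂)
  (hT : ∀ (l : SiteL2K ℂ 3 (periodsT3 F K) c₀ W₂) (f : SiteL2K ℂ 3 (periodsT3 F n) c₁ W₂), ⟪ι (Q'' l), f⟫_ℂ = ⟪l, T f⟫_ℂ)
  {a : ℝ} (ha : 0 < a)

/-! ## §3 The two Agmon rows -/

include hε₀ hε7 hreg hseq hι hT ha in
set_option maxHeartbeats 400000 in
/-- ★★★ **THE WEIGHTED-L² AND WEIGHTED-H¹ AGMON ROWS OF `G_a` AT THE T³ MEMBER** ([Balaban1985BackgroundPropagators] Thm 3.1 (3.46)-class, K-uniform).  DATA: a positive fine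
weight `w` and a positive coarse weight `w_c` with the bond ratios `|w(b₊)∕w(b₋) − 1|, |w(b₋)∕w(b₊) − 1| ≤ ρ` and the in-block ratios `|w(x)∕w_c(B(x)) − 1|, |w_c(B(x))∕w(x) − 1| ≤ ρ′`;
`δ₁ ≥ 0` with `3η⁻²ρ² + a·(25∕8)κ·ρ′² ≤ δ₁²` (`κ = c₁((L^d)^{K−n})⁻¹∕c₀`); the window `C_P·δ₁ ≤ 1∕10`, `C_P := √(max 2 (16c₀(L^{K−n})³∕(a c₁)))`.  THEN every solution of
`Δ_{U₀}u + a·T(ι(Q″u)) = f` obeys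
(A-L²) `‖toL2S(w·u)‖ ≤ 8C_P²·‖toL2S(w·f)‖`, and (A-H¹) `‖D_{U₀}(toL2S(w·u))‖² + a·‖ι(Q″(toL2S(w·u)))‖² ≤ (4C_P·‖toL2S(w·f)‖)²`.
PROOF: ✓`agmon_corrector_bound` with `D := D_{U₀} ⊕ √a·ι∘Q″`, `Pt := id`, `hPoinc := coercive_massive`, weights `w ⊕ (w(b₋), w_c∘siteShift)`, defects `K₁ := M′⁻¹∘D∘M − D` identified by
FILE A (`DL2_smul_eq_smul_add_defect`, `topMean_blockConst_smul`) and bounded by FILE A (`normSq_gradDefect_le`, `normSq_lift_topMean_le`, `norm_toL2S_smul_le`).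
[cite: Balaban1985BackgroundPropagators, Thm 3.1 (3.46) p.398, (3.24) p.394, Thm 3.11 p.416; Balaban1983RegularityDecay, (1.8) p.573] -/
theorem agmon_rows_of_massive_eq (w : Site (F.P K) 0 → ℝ) (hw : ∀ x, 0 < w x) (wc : Site (F.P K) (K - n) → ℝ) (hwc : ∀ y, 0 < wc y)
    {ρ ρ' : ℝ} (hρ' : 0 ≤ ρ')
    (hwρ : ∀ b : PBond (F.P K) 0, |w b.tgt / w b.src - 1| ≤ ρ ∧ |w b.src / w b.tgt - 1| ≤ ρ)
    (hwρ' : ∀ x : Site (F.P K) 0, |w x / wc (iterBlockOf (K - n) x) - 1| ≤ ρ' ∧ |wc (iterBlockOf (K - n) x) / w x - 1| ≤ ρ')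
    {δ₁ : ℝ} (hδ₁ : 0 ≤ δ₁)
    (hδ : 3 * ((eta F n K)⁻¹) ^ 2 * ρ ^ 2 + a * ((25 / 8) * (c₁ * ((((F.P K).L : ℝ) ^ (F.P K).d) ^ (K - n))⁻¹ / c₀)) * ρ' ^ 2 ≤ δ₁ ^ 2)
    (hwin : Real.sqrt (max 2 (16 * c₀ * ((F.L : ℝ) ^ (K - n)) ^ 3 / (a * c₁))) * δ₁ ≤ 1 / 10)
    (u f : Site (F.P K) 0 → Matrix (Fin 2) (Fin 2) ℂ)
    (hAu : covLapSite F n K c₀ U₀ (toL2S F K c₀ u) + (a : ℂ) • T (ι (Q'' (toL2S F K c₀ u))) = toL2S F K c₀ f) :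
    ‖toL2S F K c₀ (fun x => w x • u x)‖ ≤ 8 * Real.sqrt (max 2 (16 * c₀ * ((F.L : ℝ) ^ (K - n)) ^ 3 / (a * c₁))) ^ 2 * ‖toL2S F K c₀ (fun x => w x • f x)‖ ∧
      ‖DL2 F n K c₀ U₀ (toL2S F K c₀ (fun x => w x • u x))‖ ^ 2 + a * ‖ι (Q'' (toL2S F K c₀ (fun x => w x • u x)))‖ ^ 2
        ≤ (4 * Real.sqrt (max 2 (16 * c₀ * ((F.L : ℝ) ^ (K - n)) ^ 3 / (a * c₁))) * ‖toL2S F K c₀ (fun x => w x • f x)‖) ^ 2 := by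
  have hc₀ : 0 < c₀ := Fact.out
  have hc₁ : 0 < c₁ := Fact.out
  have hη : 0 < eta F n K := eta_pos F n K
  -- the gap constant
  set Mx : ℝ := max 2 (16 * c₀ * ((F.L : ℝ) ^ (K - n)) ^ 3 / (a * c₁)) with hMx
  have hMx0 : 0 < Mx := lt_of_lt_of_le (by norm_num) (le_max_left _ _)
  set CP : ℝ := Real.sqrt Mx with hCP
  have hCP0 : 0 ≤ CP := Real.sqrt_nonneg _
  have hCP2 : CP ^ 2 = Mx := Real.sq_sqrt hMx0.le
  -- the spaces
  set s : ℂ := ((Real.sqrt a : ℝ) : ℂ) with hs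
  have hss : (starRingEnd ℂ) s * s = (a : ℂ) := by
    rw [hs, Complex.conj_ofReal, ← Complex.ofReal_mul, Real.mul_self_sqrt ha.le]
  have hns : ‖s‖ ^ 2 = a := by rw [hs, Complex.norm_real, Real.norm_of_nonneg (Real.sqrt_nonneg a), Real.sq_sqrt ha.le]
  -- `D̃ := D_{U₀} ⊕ √a·ι∘Q″`
  set Φ := WithLp.linearEquiv 2 ℂ (BondL2K ℂ 3 (periodsT3 F K) c₀ W₂ × SiteL2K ℂ 3 (periodsT3 F n) c₁ W₂) with hΦ
  set Dt : SiteL2K ℂ 3 (periodsT3 F K) c₀ W₂ →ₗ[ℂ] WithLp 2 (BondL2K ℂ 3 (periodsT3 F K) c₀ W₂ × SiteL2K ℂ 3 (periodsT3 F n) c₁ W₂) :=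
    Φ.symm.toLinearMap ∘ₗ ((DL2 F n K c₀ U₀).prod (s • (ι ∘ₗ Q''))) with hDt
  have hDt_of : ∀ l, WithLp.ofLp (Dt l) = (DL2 F n K c₀ U₀ l, s • ι (Q'' l)) := fun l => by
    simp only [hDt, LinearMap.comp_apply, LinearEquiv.coe_toLinearMap, hΦ, WithLp.coe_symm_linearEquiv, WithLp.ofLp_toLp, LinearMap.prod_apply]
    rfl
  have hinnerP : ∀ x y : WithLp 2 (BondL2K ℂ 3 (periodsT3 F K) c₀ W₂ × SiteL2K ℂ 3 (periodsT3 F n) c₁ W₂),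
      ⟪x, y⟫_ℂ = ⟪(WithLp.ofLp x).1, (WithLp.ofLp y).1⟫_ℂ + ⟪(WithLp.ofLp x).2, (WithLp.ofLp y).2⟫_ℂ := fun x y => WithLp.prod_inner_apply x y
  have hnormP : ∀ x : WithLp 2 (BondL2K ℂ 3 (periodsT3 F K) c₀ W₂ × SiteL2K ℂ 3 (periodsT3 F n) c₁ W₂),
      ‖x‖ ^ 2 = ‖(WithLp.ofLp x).1‖ ^ 2 + ‖(WithLp.ofLp x).2‖ ^ 2 := fun x => by
    rw [@norm_sq_eq_re_inner ℂ, hinnerP, map_add, ← @norm_sq_eq_re_inner ℂ, ← @norm_sq_eq_re_inner ℂ]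
  have hDt_norm : ∀ l, ‖Dt l‖ ^ 2 = ‖DL2 F n K c₀ U₀ l‖ ^ 2 + a * ‖ι (Q'' l)‖ ^ 2 := fun l => by
    rw [hnormP, hDt_of, norm_smul, mul_pow, hns]
  have hDt_inner : ∀ z l, ⟪Dt z, Dt l⟫_ℂ = ⟪z, covLapSite F n K c₀ U₀ l + (a : ℂ) • T (ι (Q'' l))⟫_ℂ := fun z l => by
    rw [hinnerP, hDt_of, hDt_of, inner_smul_left, inner_smul_right, ← mul_assoc, hss, inner_add_right, inner_smul_right, ← hT,
      Summit.QuantumFields.YangMills.Theorems.Prop7SectET3HilbertLetters.covLapSite, LinearMap.comp_apply, ← adjoint_DL2, LinearMap.adjoint_inner_right]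
  -- the Poincaré row at `Pt = id`
  have hPoinc : ∀ v : SiteL2K ℂ 3 (periodsT3 F K) c₀ W₂, LinearMap.id (R := ℂ) v = v → ‖v‖ ≤ CP * ‖Dt v‖ := by
    intro v _
    have hco := coercive_massive F h hε₀ hε7 U₀ hreg Q'' hseq ι hι ha v
    rw [← hMx, ← hDt_norm, ← hCP2, ← mul_pow] at hco
    exact (pow_le_pow_iff_left₀ (norm_nonneg _) (by positivity) two_ne_zero).1 hco
  -- the multipliers
  obtain ⟨M, hM⟩ := exists_siteMul F (K := K) (c₀ := c₀) w
  obtain ⟨Mi, hMi⟩ := exists_siteMul F (K := K) (c₀ := c₀) (fun x => (w x)⁻¹)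
  obtain ⟨Mb, hMb⟩ := exists_bondMul F (K := K) (c₀ := c₀) (fun b => w b.src)
  obtain ⟨Mbi, hMbi⟩ := exists_bondMul F (K := K) (c₀ := c₀) (fun b => (w b.src)⁻¹)
  obtain ⟨Mc, hMc⟩ := exists_siteMul F (K := n) (c₀ := c₁) (fun z => wc (siteShift (sites_eq F n K h) z))
  obtain ⟨Mci, hMci⟩ := exists_siteMul F (K := n) (c₀ := c₁) (fun z => (wc (siteShift (sites_eq F n K h) z))⁻¹)
  -- every vector is a `toL2S`∕`toL2`
  have surjS : ∀ v : SiteL2K ℂ 3 (periodsT3 F K) c₀ W₂, ∃ lam, v = toL2S F K c₀ lam := fun v => ⟨(toL2S F K c₀).symm v, ((toL2S F K c₀).apply_symm_apply v).symm⟩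
  have surjB : ∀ A : BondL2K ℂ 3 (periodsT3 F K) c₀ W₂, ∃ X, A = toL2 F K c₀ X := fun A => ⟨(toL2 F K c₀).symm A, ((toL2 F K c₀).apply_symm_apply A).symm⟩
  have surjN : ∀ g : SiteL2K ℂ 3 (periodsT3 F n) c₁ W₂, ∃ lam, g = toL2S F n c₁ lam := fun g => ⟨(toL2S F n c₁).symm g, ((toL2S F n c₁).apply_symm_apply g).symm⟩
  have hMiM : ∀ v, Mi (M v) = v := fun v => by
    obtain ⟨lam, rfl⟩ := surjS v
    rw [hM, hMi]; congr 1; funext x; rw [smul_smul, inv_mul_cancel₀ (hw x).ne', one_smul]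
  have hMMi : ∀ v, M (Mi v) = v := fun v => by
    obtain ⟨lam, rfl⟩ := surjS v
    rw [hMi, hM]; congr 1; funext x; rw [smul_smul, mul_inv_cancel₀ (hw x).ne', one_smul]
  have hMbMbi : ∀ A, Mb (Mbi A) = A := fun A => by
    obtain ⟨X, rfl⟩ := surjB A
    rw [hMbi, hMb]; congr 1; funext b; rw [smul_smul, mul_inv_cancel₀ (hw b.src).ne', one_smul]
  have hMbiMb : ∀ A, Mbi (Mb A) = A := fun A => by
    obtain ⟨X, rfl⟩ := surjB A
    rw [hMb, hMbi]; congr 1; funext b; rw [smul_smul, inv_mul_cancel₀ (hw b.src).ne', one_smul]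
  have hMcMci : ∀ g, Mc (Mci g) = g := fun g => by
    obtain ⟨lam, rfl⟩ := surjN g
    rw [hMci, hMc]; congr 1; funext z; rw [smul_smul, mul_inv_cancel₀ (hwc _).ne', one_smul]
  have hMciMc : ∀ g, Mci (Mc g) = g := fun g => by
    obtain ⟨lam, rfl⟩ := surjN g
    rw [hMc, hMci]; congr 1; funext z; rw [smul_smul, inv_mul_cancel₀ (hwc _).ne', one_smul]
  -- the product weights
  set M' : WithLp 2 (BondL2K ℂ 3 (periodsT3 F K) c₀ W₂ × SiteL2K ℂ 3 (periodsT3 F n) c₁ W₂) →ₗ[ℂ] WithLp 2 (BondL2K ℂ 3 (periodsT3 F K) c₀ W₂ × SiteL2K ℂ 3 (periodsT3 F n) c₁ W₂) :=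
    Φ.symm.toLinearMap ∘ₗ (Mb.prodMap Mc) ∘ₗ Φ.toLinearMap with hM'
  set M'i : WithLp 2 (BondL2K ℂ 3 (periodsT3 F K) c₀ W₂ × SiteL2K ℂ 3 (periodsT3 F n) c₁ W₂) →ₗ[ℂ] WithLp 2 (BondL2K ℂ 3 (periodsT3 F K) c₀ W₂ × SiteL2K ℂ 3 (periodsT3 F n) c₁ W₂) :=
    Φ.symm.toLinearMap ∘ₗ (Mbi.prodMap Mci) ∘ₗ Φ.toLinearMap with hM'i
  have hM'_of : ∀ x, WithLp.ofLp (M' x) = (Mb (WithLp.ofLp x).1, Mc (WithLp.ofLp x).2) := fun x => by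
    simp only [hM', LinearMap.comp_apply, LinearEquiv.coe_toLinearMap, hΦ, WithLp.coe_symm_linearEquiv, WithLp.coe_linearEquiv, WithLp.ofLp_toLp,
      LinearMap.prodMap_apply]
  have hM'i_of : ∀ x, WithLp.ofLp (M'i x) = (Mbi (WithLp.ofLp x).1, Mci (WithLp.ofLp x).2) := fun x => by
    simp only [hM'i, LinearMap.comp_apply, LinearEquiv.coe_toLinearMap, hΦ, WithLp.coe_symm_linearEquiv, WithLp.coe_linearEquiv, WithLp.ofLp_toLp,
      LinearMap.prodMap_apply]
  have ofLp_inj : ∀ x y : WithLp 2 (BondL2K ℂ 3 (periodsT3 F K) c₀ W₂ × SiteL2K ℂ 3 (periodsT3 F n) c₁ W₂), WithLp.ofLp x = WithLp.ofLp y → x = y :=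
    fun x y hxy => by rw [← WithLp.toLp_ofLp (p := 2) x, hxy, WithLp.toLp_ofLp]
  have hM'M'i : ∀ x, M' (M'i x) = x := fun x => ofLp_inj _ _ (by rw [hM'_of, hM'i_of, hMbMbi, hMcMci])
  have hM'iM' : ∀ x, M'i (M' x) = x := fun x => ofLp_inj _ _ (by rw [hM'i_of, hM'_of, hMbiMb, hMciMc])
  have hpair : ∀ x y, ⟪M' x, M'i y⟫_ℂ = ⟪x, y⟫_ℂ := fun x y => by
    rw [hinnerP, hinnerP x y, hM'_of, hM'i_of]
    obtain ⟨X, hX⟩ := surjB (WithLp.ofLp x).1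
    obtain ⟨Y, hY⟩ := surjB (WithLp.ofLp y).1
    obtain ⟨g, hg⟩ := surjN (WithLp.ofLp x).2
    obtain ⟨g', hg'⟩ := surjN (WithLp.ofLp y).2
    simp only [hX, hY, hg, hg', hMb, hMbi, hMc, hMci]
    rw [inner_toL2_smul_smul_inv F (fun b => w b.src) (fun b => (hw b.src).ne'), inner_toL2S_smul_smul_inv F _ (fun z => (hwc _).ne')]
  -- the defects `K₁ := M′⁻¹∘D̃∘M − D̃`, `K₁′ := M′∘D̃∘M⁻¹ − D̃`; no constraint defects
  set K₁ : SiteL2K ℂ 3 (periodsT3 F K) c₀ W₂ →ₗ[ℂ] WithLp 2 (BondL2K ℂ 3 (periodsT3 F K) c₀ W₂ × SiteL2K ℂ 3 (periodsT3 F n) c₁ W₂) := M'i ∘ₗ Dt ∘ₗ M - Dt with hK₁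
  set K₁' : SiteL2K ℂ 3 (periodsT3 F K) c₀ W₂ →ₗ[ℂ] WithLp 2 (BondL2K ℂ 3 (periodsT3 F K) c₀ W₂ × SiteL2K ℂ 3 (periodsT3 F n) c₁ W₂) := M' ∘ₗ Dt ∘ₗ Mi - Dt with hK₁'
  have hK₁id : ∀ v, Dt (M v) = M' (Dt v + K₁ v) := fun v => by
    simp only [hK₁, LinearMap.sub_apply, LinearMap.comp_apply, add_sub_cancel, hM'M'i]
  have hK₁'id : ∀ v, Dt (Mi v) = M'i (Dt v + K₁' v) := fun v => by
    simp only [hK₁', LinearMap.sub_apply, LinearMap.comp_apply, add_sub_cancel, hM'iM']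
  have hK₂id : ∀ v, LinearMap.id (R := ℂ) (M v) = M (LinearMap.id (R := ℂ) v + (0 : SiteL2K ℂ 3 (periodsT3 F K) c₀ W₂ →ₗ[ℂ] SiteL2K ℂ 3 (periodsT3 F K) c₀ W₂) v) :=
    fun v => by simp only [LinearMap.id_apply, LinearMap.zero_apply, add_zero]
  have hK₂'id : ∀ v, LinearMap.id (R := ℂ) (Mi v) = Mi (LinearMap.id (R := ℂ) v + (0 : SiteL2K ℂ 3 (periodsT3 F K) c₀ W₂ →ₗ[ℂ] SiteL2K ℂ 3 (periodsT3 F K) c₀ W₂) v) :=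
    fun v => by simp only [LinearMap.id_apply, LinearMap.zero_apply, add_zero]
  -- κ and the defect bound
  set κ : ℝ := c₁ * ((((F.P K).L : ℝ) ^ (F.P K).d) ^ (K - n))⁻¹ / c₀ with hκ
  have hκ0 : 0 ≤ κ := by rw [hκ]; have := (F.P K).L_pos; positivity
  -- generic defect bound: weight `w₁` with inverse `wi₁`, coarse `wc₁` with inverse `wci₁`
  have hdef : ∀ (w₁ wi₁ : Site (F.P K) 0 → ℝ) (hwi₁ : ∀ x, wi₁ x * w₁ x = 1) (wci₁ : Site (F.P K) (K - n) → ℝ)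
      (hρ₁ : ∀ b : PBond (F.P K) 0, |w₁ b.tgt / w₁ b.src - 1| ≤ ρ) (hρ₁' : ∀ x, |wci₁ (iterBlockOf (K - n) x) * w₁ x - 1| ≤ ρ')
      (N : SiteL2K ℂ 3 (periodsT3 F K) c₀ W₂ →ₗ[ℂ] SiteL2K ℂ 3 (periodsT3 F K) c₀ W₂) (hN : ∀ lam, N (toL2S F K c₀ lam) = toL2S F K c₀ (fun x => w₁ x • lam x))
      (Nbi : BondL2K ℂ 3 (periodsT3 F K) c₀ W₂ →ₗ[ℂ] BondL2K ℂ 3 (periodsT3 F K) c₀ W₂) (hNbi : ∀ A, Nbi (toL2 F K c₀ A) = toL2 F K c₀ (fun b => wi₁ b.src • A b))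
      (Nci : SiteL2K ℂ 3 (periodsT3 F n) c₁ W₂ →ₗ[ℂ] SiteL2K ℂ 3 (periodsT3 F n) c₁ W₂)
      (hNci : ∀ g, Nci (toL2S F n c₁ g) = toL2S F n c₁ (fun z => wci₁ (siteShift (sites_eq F n K h) z) • g z))
      (Ngen : WithLp 2 (BondL2K ℂ 3 (periodsT3 F K) c₀ W₂ × SiteL2K ℂ 3 (periodsT3 F n) c₁ W₂) →ₗ[ℂ] WithLp 2 (BondL2K ℂ 3 (periodsT3 F K) c₀ W₂ × SiteL2K ℂ 3 (periodsT3 F n) c₁ W₂))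
      (hNgen : ∀ x, WithLp.ofLp (Ngen x) = (Nbi (WithLp.ofLp x).1, Nci (WithLp.ofLp x).2))
      (v : SiteL2K ℂ 3 (periodsT3 F K) c₀ W₂), ‖Ngen (Dt (N v)) - Dt v‖ ≤ δ₁ * ‖v‖ := by
    intro w₁ wi₁ hwi₁ wci₁ hρ₁ hρ₁' N hN Nbi hNbi Nci hNci Ngen hNgen v
    obtain ⟨lam, rfl⟩ := surjS v
    -- components of the defect
    have hof : WithLp.ofLp (Ngen (Dt (N (toL2S F K c₀ lam))) - Dt (toL2S F K c₀ lam))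
        = (Nbi (DL2 F n K c₀ U₀ (toL2S F K c₀ (fun x => w₁ x • lam x))) - DL2 F n K c₀ U₀ (toL2S F K c₀ lam),
           Nci (s • ι (Q'' (toL2S F K c₀ (fun x => w₁ x • lam x)))) - s • ι (Q'' (toL2S F K c₀ lam))) := by
      rw [WithLp.ofLp_sub, hNgen, hDt_of, hDt_of, hN, Prod.mk_sub_mk]
    have hbond := bondMulInv_DL2_siteMul_sub F (n := n) U₀ w₁ wi₁ hwi₁ Nbi hNbi lam
    have hcoarse : Nci (s • ι (Q'' (toL2S F K c₀ (fun x => w₁ x • lam x)))) - s • ι (Q'' (toL2S F K c₀ lam))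
        = s • ι (Q'' (toL2S F K c₀ (fun x => (wci₁ (iterBlockOf (K - n) x) * w₁ x - 1) • lam x))) := by
      rw [map_smul, ← smul_sub, siteMulInv_lift_topMean_siteMul_sub F h U₀ Q'' hseq ι hι w₁ wci₁ Nci hNci lam]
    -- norms
    have hnb := normSq_gradDefect_le F U₀ w₁ hρ₁ lam (c₀ := c₀) (n := n)
    have hnc : ‖s • ι (Q'' (toL2S F K c₀ (fun x => (wci₁ (iterBlockOf (K - n) x) * w₁ x - 1) • lam x)))‖ ^ 2
        ≤ a * ((25 / 8) * κ) * ρ' ^ 2 * ‖toL2S F K c₀ lam‖ ^ 2 := by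
      rw [norm_smul, mul_pow, hns, hι]
      have h1 := normSq_lift_topMean_le F U₀ Q'' hseq h (c₁ := c₁) hε₀ hε7 hreg (fun x => (wci₁ (iterBlockOf (K - n) x) * w₁ x - 1) • lam x)
      have h2 := norm_toL2S_smul_le F (c₀ := c₀) (fun x => wci₁ (iterBlockOf (K - n) x) * w₁ x - 1) hρ' hρ₁' lam
      have h3 : ‖toL2S F K c₀ (fun x => (wci₁ (iterBlockOf (K - n) x) * w₁ x - 1) • lam x)‖ ^ 2 ≤ (ρ' * ‖toL2S F K c₀ lam‖) ^ 2 :=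
        pow_le_pow_left₀ (norm_nonneg _) h2 2
      rw [← hκ] at h1
      calc a * ‖toL2S F n c₁ (fun z => Q'' (toL2S F K c₀ fun x => (wci₁ (iterBlockOf (K - n) x) * w₁ x - 1) • lam x) (siteShift (sites_eq F n K h) z))‖ ^ 2
          ≤ a * ((25 / 8) * κ * (ρ' * ‖toL2S F K c₀ lam‖) ^ 2) := mul_le_mul_of_nonneg_left (h1.trans (mul_le_mul_of_nonneg_left h3 (by positivity))) ha.le
        _ = _ := by ring
    have htot : ‖Ngen (Dt (N (toL2S F K c₀ lam))) - Dt (toL2S F K c₀ lam)‖ ^ 2 ≤ (δ₁ * ‖toL2S F K c₀ lam‖) ^ 2 := by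
      rw [hnormP, hof, hbond, hcoarse]
      calc ‖toL2 F K c₀ (fun b => ((eta F n K)⁻¹ * (w₁ b.tgt / w₁ b.src - 1)) • R (bgUnits F K U₀ b) (lam b.tgt))‖ ^ 2
            + ‖s • ι (Q'' (toL2S F K c₀ (fun x => (wci₁ (iterBlockOf (K - n) x) * w₁ x - 1) • lam x)))‖ ^ 2
          ≤ 3 * ((eta F n K)⁻¹) ^ 2 * ρ ^ 2 * ‖toL2S F K c₀ lam‖ ^ 2 + a * ((25 / 8) * κ) * ρ' ^ 2 * ‖toL2S F K c₀ lam‖ ^ 2 := add_le_add hnb hnc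
        _ = (3 * ((eta F n K)⁻¹) ^ 2 * ρ ^ 2 + a * ((25 / 8) * κ) * ρ' ^ 2) * ‖toL2S F K c₀ lam‖ ^ 2 := by ring
        _ ≤ δ₁ ^ 2 * ‖toL2S F K c₀ lam‖ ^ 2 := mul_le_mul_of_nonneg_right hδ (sq_nonneg _)
        _ = (δ₁ * ‖toL2S F K c₀ lam‖) ^ 2 := by ring
    exact (pow_le_pow_iff_left₀ (norm_nonneg _) (by positivity) two_ne_zero).1 htot
  have bK₁ : ∀ v, ‖K₁ v‖ ≤ δ₁ * ‖v‖ := fun v => by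
    have e : K₁ v = M'i (Dt (M v)) - Dt v := by simp only [hK₁, LinearMap.sub_apply, LinearMap.comp_apply]
    rw [e]
    exact hdef w (fun x => (w x)⁻¹) (fun x => inv_mul_cancel₀ (hw x).ne') (fun y => (wc y)⁻¹) (fun b => (hwρ b).1)
      (fun x => by rw [← div_eq_inv_mul]; exact (hwρ' x).1) M hM Mbi hMbi Mci hMci M'i hM'i_of v
  have bK₁' : ∀ v, ‖K₁' v‖ ≤ δ₁ * ‖v‖ := fun v => by
    have e : K₁' v = M' (Dt (Mi v)) - Dt v := by simp only [hK₁', LinearMap.sub_apply, LinearMap.comp_apply]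
    rw [e]
    refine hdef (fun x => (w x)⁻¹) w (fun x => mul_inv_cancel₀ (hw x).ne') wc (fun b => ?_) (fun x => ?_) Mi hMi Mb
      hMb Mc hMc M' hM'_of v
    · have := (hwρ b).2
      rwa [inv_div_inv] 
    · have := (hwρ' x).2
      rwa [← div_eq_mul_inv]
  -- the equation, tested
  have heq : ∀ z, LinearMap.id (R := ℂ) z = z → ⟪Dt z, Dt (toL2S F K c₀ u)⟫_ℂ = ⟪z, toL2S F K c₀ f⟫_ℂ := fun z _ => by
    rw [hDt_inner, hAu]
  -- the source term
  have hMf : M (toL2S F K c₀ f) = toL2S F K c₀ (fun x => w x • f x) := hM f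
  have hf' : ∀ v, ‖⟪LinearMap.id (R := ℂ) (M v), toL2S F K c₀ f⟫_ℂ‖ ≤ ‖toL2S F K c₀ (fun x => w x • f x)‖ * ‖v‖ := fun v => by
    obtain ⟨lam, rfl⟩ := surjS v
    rw [LinearMap.id_apply, hM, inner_toL2S_smul_left, mul_comm]
    exact norm_inner_le_norm _ _
  -- the windows
  have hsmall₁ : (0 : ℝ) + CP * 0 ≤ 1 / 2 := by norm_num
  have hsmall₂ : 2 * CP * (δ₁ + (2 * 0 + δ₁ * (1 + 2 * 0))) + 4 * CP ^ 2 * ((2 * 0 + δ₁ * (1 + 2 * 0)) * δ₁) ≤ 1 / 2 := by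
    have ht : 0 ≤ CP * δ₁ := mul_nonneg hCP0 hδ₁
    nlinarith [hwin, ht]
  -- Agmon
  have hmain := agmon_corrector_bound Dt LinearMap.id (fun v => rfl) hCP0 hPoinc M Mi M' M'i hMiM hMMi hpair K₁ K₁' 0 0 hK₁id hK₁'id hK₂id hK₂'id
    hδ₁ le_rfl le_rfl bK₁ bK₁' (fun v => by rw [LinearMap.zero_apply, norm_zero, zero_mul]) (fun v => by rw [LinearMap.zero_apply, norm_zero, zero_mul])
    (fun v => by rw [LinearMap.zero_apply, map_zero, norm_zero, zero_mul]) (fun v => by rw [LinearMap.zero_apply, map_zero, norm_zero, zero_mul])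
    hsmall₁ hsmall₂ (toL2S F K c₀ u) rfl (toL2S F K c₀ f) heq (norm_nonneg _) hf'
  obtain ⟨hH, hL⟩ := hmain
  rw [hM] at hH hL
  refine ⟨hL, ?_⟩
  rw [← hDt_norm]
  exact pow_le_pow_left₀ (norm_nonneg _) hH 2

/-! ## §4 Exponential weights -/

include hε₀ hε7 hreg hseq hι hT ha in
/-- ★★★ **THE AGMON ROWS WITH EXPONENTIAL WEIGHTS** — `w = e^{φ}`, `w_c = e^{φ_c}` for a fine-Lipschitz `φ` (`|φ(b₊) − φ(b₋)| ≤ θ` on every bond) whose in-block oscillation against the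
coarse `φ_c` is `≤ θ′` (`|φ(x) − φ_c(B(x))| ≤ θ′`); `ρ = e^{θ} − 1`, `ρ′ = e^{θ′} − 1`.  In the window `C_P·δ₁ ≤ 1∕10`, `3η⁻²(e^{θ} − 1)² + a·(25∕8)κ·(e^{θ′} − 1)² ≤ δ₁²`, every
solution of `Δ_{U₀}u + a·T(ι(Q″u)) = f` obeys (A-L²) `‖toL2S(e^{φ}·u)‖ ≤ 8C_P²·‖toL2S(e^{φ}·f)‖` and (A-H¹) `‖D_{U₀}(toL2S(e^{φ}·u))‖² + a‖ι(Q″(toL2S(e^{φ}·u)))‖² ≤ (4C_P‖toL2S(e^{φ}·f)‖)²`.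
THE (3.46)-CLASS USE: `φ := μη·dist(·, S)` (graph distance to the support `S` of `f`, slope `θ = μη ≤ 1` so `η⁻¹ρ ≤ e·μ`; `φ_c(y) := φ` at any site of `B(y)`, `θ′ ≤ 3μ`) gives
`e^{μη·dist(S′,S)}·‖𝟙_{S′}u‖ ≤ 8C_P²‖f‖` for every fine set `S′` — K-, L-, volume-uniform. [cite: Balaban1985BackgroundPropagators, Thm 3.1 (3.46) p.398, (3.24) p.394; Balaban1983RegularityDecay, (1.8) p.573] -/
theorem agmon_rows_exp (φ : Site (F.P K) 0 → ℝ) (φc : Site (F.P K) (K - n) → ℝ) {θ θ' : ℝ} (hθ' : 0 ≤ θ')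
    (hφ : ∀ b : PBond (F.P K) 0, |φ b.tgt - φ b.src| ≤ θ) (hφc : ∀ x : Site (F.P K) 0, |φ x - φc (iterBlockOf (K - n) x)| ≤ θ')
    {δ₁ : ℝ} (hδ₁ : 0 ≤ δ₁)
    (hδ : 3 * ((eta F n K)⁻¹) ^ 2 * (Real.exp θ - 1) ^ 2 + a * ((25 / 8) * (c₁ * ((((F.P K).L : ℝ) ^ (F.P K).d) ^ (K - n))⁻¹ / c₀)) * (Real.exp θ' - 1) ^ 2 ≤ δ₁ ^ 2)
    (hwin : Real.sqrt (max 2 (16 * c₀ * ((F.L : ℝ) ^ (K - n)) ^ 3 / (a * c₁))) * δ₁ ≤ 1 / 10)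
    (u f : Site (F.P K) 0 → Matrix (Fin 2) (Fin 2) ℂ)
    (hAu : covLapSite F n K c₀ U₀ (toL2S F K c₀ u) + (a : ℂ) • T (ι (Q'' (toL2S F K c₀ u))) = toL2S F K c₀ f) :
    ‖toL2S F K c₀ (fun x => Real.exp (φ x) • u x)‖ ≤ 8 * Real.sqrt (max 2 (16 * c₀ * ((F.L : ℝ) ^ (K - n)) ^ 3 / (a * c₁))) ^ 2 * ‖toL2S F K c₀ (fun x => Real.exp (φ x) • f x)‖ ∧
      ‖DL2 F n K c₀ U₀ (toL2S F K c₀ (fun x => Real.exp (φ x) • u x))‖ ^ 2 + a * ‖ι (Q'' (toL2S F K c₀ (fun x => Real.exp (φ x) • u x)))‖ ^ 2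
        ≤ (4 * Real.sqrt (max 2 (16 * c₀ * ((F.L : ℝ) ^ (K - n)) ^ 3 / (a * c₁))) * ‖toL2S F K c₀ (fun x => Real.exp (φ x) • f x)‖) ^ 2 := by
  have hρ' : 0 ≤ Real.exp θ' - 1 := by linarith [Real.one_le_exp hθ']
  refine agmon_rows_of_massive_eq F h hε₀ hε7 U₀ hreg Q'' hseq ι hι T hT ha (fun x => Real.exp (φ x)) (fun x => Real.exp_pos _)
    (fun y => Real.exp (φc y)) (fun y => Real.exp_pos _) hρ' (fun b => ⟨?_, ?_⟩) (fun x => ⟨?_, ?_⟩) hδ₁ hδ hwin u f hAu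
  · rw [← Real.exp_sub]; exact abs_exp_sub_one_le (hφ b)
  · rw [← Real.exp_sub]; exact abs_exp_sub_one_le (by rw [abs_sub_comm]; exact hφ b)
  · rw [← Real.exp_sub]; exact abs_exp_sub_one_le (hφc x)
  · rw [← Real.exp_sub]; exact abs_exp_sub_one_le (by rw [abs_sub_comm]; exact hφc x)

end Summit.QuantumFields.YangMills.Theorems.Prop7MassivePropagatorAgmon

end
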